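import Summits.AnomalousDissipation.AnomalousDissipation.Theorems.MirrorVarietyTaylorGreenLoudGalerkinStatesStubDiscreteKantorovich
import Summits.AnomalousDissipation.AnomalousDissipation.Theorems.MirrorVarietyTaylorGreenLoudGalerkinStatesStubTgForceRegular
import Summits.AnomalousDissipation.AnomalousDissipation.Theorems.TaylorGreenLogLoudStates.Negative.Eigenforce

/-!
# Stub `stub_gaugeNorms` of the line `stagnation-plug-froth`
# (crux stmt-AnomalousDissipation-2987, `MirrorVariety.TaylorGreenLoudGalerkinStates`)

Orthogonality bookkeeping of the amplitude gauge `U = 2 f_TG + v`, `v ⊥ f_TG` in `L²`, used by the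
lead's glue `stub_froth_of_gauge`.  For a `K`-field `v` with `∫⟪f_TG, v⟫ = 0`:

* `2 f_TG + v` is a `K`-field (smooth, divergence-free, mean-zero, `K`-symmetric: all four are
  real-linear conditions, and `f_TG` is a `K`-field by `TgForceRegular.stub_tgForceRegular`);
* energy: `∫|2 f_TG + v|² = 4∫|f_TG|² + 4∫⟪f_TG, v⟫ + ∫|v|² = 1 + ∫|v|²`
  (`Negative.integral_norm_sq_tgForce : ∫|f_TG|² = 1/4`);
* enstrophy: `‖∇(2 f_TG + v)‖² = 12π² + ‖∇v‖²`.  We polarise Green's first identity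
  `‖∇w‖² = -∫⟪w, Δw⟫` (`Torus.integral_inner_laplacian_eq_neg_holds`): with
  `Δ(2f + v) = 2Δf + Δv`, the cross terms are `∫⟪v, Δf_TG⟫ = -12π²∫⟪f_TG, v⟫ = 0`
  (`f_TG` is a Stokes eigenfield, `TaylorGreenLogLoudStates.Negative.integral_inner_laplacian_tgForce`)
  and `∫⟪f_TG, Δv⟫ = ∫⟪Δf_TG, v⟫ = 0` (Green's second identity `Torus.integral_inner_laplacian_comm`),
  while `-∫⟪f_TG, Δf_TG⟫ = 12π² ∫|f_TG|² = 3π²`.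

Sources: Temam, *Navier–Stokes Equations* (1979) Ch. II §1; Evans (2010) App. C.2 Thm. 3 (Green's
identities); the mathematics is folklore.
-/

-- `Summit.<Summit>.<Problem>` is the tree's mandated summit-side namespace (CONVENTIONS §2); for this
-- single-conjunct summit the two coincide, so the duplicate is deliberate.
set_option linter.dupNamespace false

noncomputable section

open scoped BigOperators Topology InnerProductSpace
open Filter MeasureTheory
open Literature.Analysis.FunctionSpaces Literature.Analysis.FunctionSpaces.Torus

namespace Summit.AnomalousDissipation.AnomalousDissipation.Theorems.TaylorGreenLoudGalerkinStates.GaugeNorms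

open Summit.AnomalousDissipation.AnomalousDissipation.Theorems.TaylorGreenLoudGalerkinStates
open Summit.AnomalousDissipation.AnomalousDissipation.Theorems.TaylorGreenLoudGalerkinStates.Negative

/-! ## Green's first identity in `gradNormSq` form, and the linear closure properties -/

/-- Green's first identity for the enstrophy: `‖∇w‖² = -∫⟪w, Δw⟫` for smooth `w`
(`Torus.integral_inner_laplacian_eq_neg_holds`, summed). [folklore] -/
theorem gradNormSq_eq_neg_integral {w : UnitAddTorus (Fin 3) → EuclideanSpace ℝ (Fin 3)}
    (hw : IsSmooth w) : gradNormSq w = -∫ x, ⟪w x, laplacian w x⟫_ℝ := by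
  rw [integral_inner_laplacian_eq_neg_holds hw, neg_neg, gradNormSq,
    integral_finsetSum _ fun i _ => ((hw.partialDeriv i).norm_sq).integrable]

/-- Sums `c • u + v` of smooth divergence-free fields are divergence free (the divergence is the
trace of the torus derivative, which is linear). [folklore] -/
theorem isDivFree_smul_add {u v : UnitAddTorus (Fin 3) → EuclideanSpace ℝ (Fin 3)} (c : ℝ)
    (hu : IsSmooth u) (hv : IsSmooth v) (hud : IsDivFree u) (hvd : IsDivFree v) :
    IsDivFree (c • u + v) := by
  intro x
  have hu1 : IsContDiff 1 u := hu.isContDiff (by simp)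
  have hv1 : IsContDiff 1 v := hv.isContDiff (by simp)
  have hcu1 : IsContDiff 1 (c • u) := hu1.smul c
  rw [divergence_eq_trace_fderiv (hcu1.add hv1), fderiv_add hcu1 hv1, fderiv_const_smul hu1,
    ContinuousLinearMap.toLinearMap_add, ContinuousLinearMap.toLinearMap_smul, map_add, map_smul,
    ← divergence_eq_trace_fderiv hu1, ← divergence_eq_trace_fderiv hv1, hud x, hvd x, smul_zero,
    add_zero]

/-- Sums `c • u + v` of continuous mean-zero fields have zero mean. [folklore] -/
theorem hasZeroMean_smul_add {u v : UnitAddTorus (Fin 3) → EuclideanSpace ℝ (Fin 3)} (c : ℝ)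
    (hu : Continuous u) (hv : Continuous v) (hu0 : HasZeroMean u) (hv0 : HasZeroMean v) :
    HasZeroMean (c • u + v) := by
  have hu0' : ∫ x, u x = 0 := hu0
  have hv0' : ∫ x, v x = 0 := hv0
  show ∫ x, (c • u + v) x = 0
  simp only [Pi.add_apply, Pi.smul_apply]
  have hcu : Integrable (fun x => c • u x) volume := hu.integrable_unitAddTorus.smul c
  rw [integral_add hcu hv.integrable_unitAddTorus, integral_smul, hu0', hv0', smul_zero, add_zero]

/-- `‖c • a + b‖² = c²‖a‖² + 2c⟪a, b⟫ + ‖b‖²` in a real inner product space. [folklore] -/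
theorem norm_sq_smul_add (c : ℝ) (a b : EuclideanSpace ℝ (Fin 3)) :
    ‖c • a + b‖ ^ 2 = c ^ 2 * ‖a‖ ^ 2 + 2 * c * ⟪a, b⟫_ℝ + ‖b‖ ^ 2 := by
  rw [norm_add_sq_real, norm_smul, real_inner_smul_left, mul_pow, Real.norm_eq_abs, sq_abs]
  ring

/-! ## The registered stub -/

/-- **stub_gaugeNorms** (orthogonality bookkeeping of the gauge).  For a `K`-field `v ⊥ f_TG`:
`2f_TG + v` is a `K`-field, `∫|2f_TG + v|² = 1 + ∫|v|²` (`∫|f_TG|² = 1/4`), and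
`‖∇(2f_TG + v)‖² = 12π² + ‖∇v‖²` (polarised Green identity; the cross terms are multiples of
`∫⟪f_TG, v⟫ = 0` because `Δ f_TG = -12π² f_TG`, and `‖∇f_TG‖² = -∫⟪f_TG, Δf_TG⟫ = 3π²`). [folklore] -/
theorem stub_gaugeNorms :
    ∀ v : UnitAddTorus (Fin 3) → EuclideanSpace ℝ (Fin 3), IsKField v →
      (∫ x, inner ℝ (tgForce x) (v x)) = 0 →
      IsKField ((2 : ℝ) • tgForce + v) ∧
        (∫ x, ‖((2 : ℝ) • tgForce + v) x‖ ^ 2) = 1 + ∫ x, ‖v x‖ ^ 2 ∧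
        gradNormSq ((2 : ℝ) • tgForce + v) = 12 * Real.pi ^ 2 + gradNormSq v := by
  intro v hv horth
  obtain ⟨hvs, hvd, hv0, hvK⟩ := hv
  have hfs : IsSmooth tgForce := isSmooth_tgForce
  have h2fs : IsSmooth ((2 : ℝ) • tgForce) := hfs.smul 2
  have hUs : IsSmooth ((2 : ℝ) • tgForce + v) := h2fs.add hvs
  refine ⟨⟨hUs, isDivFree_smul_add 2 hfs hvs isDivFree_tgForce hvd,
    hasZeroMean_smul_add 2 continuous_tgForce hvs.continuous hasZeroMean_tgForce hv0,
    DiscreteKantorovich.isKSymm_add (DiscreteKantorovich.isKSymm_smul 2 TgForceRegular.isKSymm_tgForce) hvK⟩,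
    ?_, ?_⟩
  · -- ### energy: `∫|2f + v|² = 4∫|f|² + 4∫⟪f, v⟫ + ∫|v|² = 1 + ∫|v|²`
    have hpt : ∀ x, ‖((2 : ℝ) • tgForce + v) x‖ ^ 2 =
        4 * ‖tgForce x‖ ^ 2 + 4 * ⟪tgForce x, v x⟫_ℝ + ‖v x‖ ^ 2 := by
      intro x
      rw [Pi.add_apply, Pi.smul_apply, norm_sq_smul_add]
      ring
    simp_rw [hpt]
    have i1 : Integrable (fun x => 4 * ‖tgForce x‖ ^ 2) volume :=
      ((continuous_tgForce.norm.pow 2).integrable_unitAddTorus).const_mul 4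
    have i2 : Integrable (fun x => 4 * ⟪tgForce x, v x⟫_ℝ) volume :=
      ((continuous_tgForce.inner hvs.continuous).integrable_unitAddTorus).const_mul 4
    have i3 : Integrable (fun x => ‖v x‖ ^ 2) volume := (hvs.continuous.norm.pow 2).integrable_unitAddTorus
    have i12 : Integrable (fun x => 4 * ‖tgForce x‖ ^ 2 + 4 * ⟪tgForce x, v x⟫_ℝ) volume := i1.add i2
    rw [integral_add i12 i3, integral_add i1 i2, integral_const_mul, integral_const_mul,
      integral_norm_sq_tgForce, horth]
    norm_num
  · -- ### enstrophy: polarise `‖∇w‖² = -∫⟪w, Δw⟫`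
    have hlapU : ∀ x, laplacian ((2 : ℝ) • tgForce + v) x = (2 : ℝ) • laplacian tgForce x + laplacian v x := by
      intro x
      rw [laplacian_add_apply h2fs hvs, laplacian_const_smul_apply hfs]
    have hpt : ∀ x, ⟪((2 : ℝ) • tgForce + v) x, laplacian ((2 : ℝ) • tgForce + v) x⟫_ℝ =
        4 * ⟪tgForce x, laplacian tgForce x⟫_ℝ + 2 * ⟪tgForce x, laplacian v x⟫_ℝ +
          2 * ⟪v x, laplacian tgForce x⟫_ℝ + ⟪v x, laplacian v x⟫_ℝ := by
      intro x
      rw [hlapU x, Pi.add_apply, Pi.smul_apply]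
      simp only [inner_add_left, inner_add_right, real_inner_smul_left, real_inner_smul_right]
      ring
    rw [gradNormSq_eq_neg_integral hUs, gradNormSq_eq_neg_integral hvs]
    simp_rw [hpt]
    have j1 : Integrable (fun x => 4 * ⟪tgForce x, laplacian tgForce x⟫_ℝ) volume :=
      (hfs.inner hfs.laplacian).integrable.const_mul 4
    have j2 : Integrable (fun x => 2 * ⟪tgForce x, laplacian v x⟫_ℝ) volume :=
      (hfs.inner hvs.laplacian).integrable.const_mul 2
    have j3 : Integrable (fun x => 2 * ⟪v x, laplacian tgForce x⟫_ℝ) volume :=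
      (hvs.inner hfs.laplacian).integrable.const_mul 2
    have j4 : Integrable (fun x => ⟪v x, laplacian v x⟫_ℝ) volume := (hvs.inner hvs.laplacian).integrable
    have j12 : Integrable (fun x => 4 * ⟪tgForce x, laplacian tgForce x⟫_ℝ +
        2 * ⟪tgForce x, laplacian v x⟫_ℝ) volume := j1.add j2
    have j123 : Integrable (fun x => 4 * ⟪tgForce x, laplacian tgForce x⟫_ℝ +
        2 * ⟪tgForce x, laplacian v x⟫_ℝ + 2 * ⟪v x, laplacian tgForce x⟫_ℝ) volume := j12.add j3
    rw [integral_add j123 j4, integral_add j12 j3, integral_add j1 j2,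
      integral_const_mul, integral_const_mul, integral_const_mul]
    -- the Stokes eigenfield evaluations
    have e1 : ∫ x, ⟪tgForce x, laplacian tgForce x⟫_ℝ = -(3 * Real.pi ^ 2) := by
      rw [TaylorGreenLogLoudStates.Negative.integral_inner_laplacian_tgForce (hfs.memLp 2)]
      simp_rw [real_inner_self_eq_norm_sq]
      rw [integral_norm_sq_tgForce]
      ring
    have e2 : ∫ x, ⟪v x, laplacian tgForce x⟫_ℝ = 0 := by
      rw [TaylorGreenLogLoudStates.Negative.integral_inner_laplacian_tgForce (hvs.memLp 2), horth, mul_zero]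
    have e3 : ∫ x, ⟪tgForce x, laplacian v x⟫_ℝ = 0 := by
      rw [← integral_inner_laplacian_comm hfs hvs, ← e2]
      exact integral_congr_ae (ae_of_all _ fun x => real_inner_comm _ _)
    rw [e1, e2, e3]
    ring

end Summit.AnomalousDissipation.AnomalousDissipation.Theorems.TaylorGreenLoudGalerkinStates.GaugeNorms

end
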